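import Summits.QuantumFields.YangMills.Theorems.SwapVirialDeficitBlowUpGnomonicTipFrameSplit
import Summits.QuantumFields.YangMills.Theorems.SwapVirialDeficitBlowUpGnomonicApexSoftLine
import Summits.QuantumFields.YangMills.Theorems.SwapVirialDeficitSectorLaplaceEndLeaderFubini
import HarnessLib

/-!
# Route `SwapVirialDeficit` (YangMills): THE TRANSVERSE (OTHER-LEADER) INTEGRAL OF THE ALIGNED FRAME (hCore F5a, region PX)
# (cell ym-idea-1, skeleton ➎, `stub_core_tip`, the core; free-hands support of ⟨stmt-QuantumFields-24197⟩ `SwapVirialDeficit.SwapGluedStiffness`)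

Pure analysis, no deficit.  For a fixed leader `x ≠ 0` (`N = |x|²`), a rate `β > 0` and any measurable `K : ℝ × ℝ → ℝ≥0∞` (the reference factor
`e^{3∕2}G_b∕√det A₀(gnoBase p′)` of ✓`tipPX_pointwise`, read at the reference base point `p′ = (√N, x·y∕√N)`):
★★ `lintegral_transverse_le` —
`∫⁻_{|y|² ≤ N} w(y)·e^{−β·Cross(x,y)}·K(√N, x·y∕√N) dy ≤ ofReal(π²(1+N)∕(4βN)) · ∫⁻_{b² ≤ N} (1+b²)⁻¹·K(√N, b) db`,
`Cross = 4|x×y|²∕((1+|x|²)(1+|y|²))`, `w = gnomonicWeight`.  Route (memo S3S4-aligned §2, LEAD (B8)): rotate `y = rot3 u Y` with `rot3 u e₀ = x̂`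
(✓`exists_rot3_e0_eq`, ✓`lintegral_rot3_comp`): `x·y = √N·Y₀`, `|x×y|² = N(Y₁²+Y₂²)` (✓`rot3_frame_coords` + Lagrange), `|y| = |Y|`; split `Y = (b, w̃)`
(✓`lintegral_fin3_eq_lintegral_prod`); the `w̃`-integral is the compressed plane Gaussian ✓`SigmaBall.lintegral_plane_pi_le` with `A = 1+b²`, `κ = 4βN∕(1+N)`
— Gaussian near `w̃ = 0`, `e^{−u} ≤ 1∕u` beyond, no tail and no `1∕|p|` corner.

HONEST LABEL: one analytic brick; the axial cone integral (F5b), `leaderLayer_PX∕PY`, `hLLm`, hCore, `stub_core_tip`, ⟨24197⟩ ∕ ⟨24194⟩ remain OPEN; own crux ⟨22884⟩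
`LargeFieldMassRefinementTail` OPEN (blocked-on ⟨19935⟩); the Yang–Mills mass gap is NOT proved; no summit is proved by a line.
THEOREMS ONLY (0 `def`, 0 `sorry`, no instance), standard axioms.  Width seat ym-line-sfw-p2-w2 g61 (cell ym-idea-1, free hands), `--supports stmt-QuantumFields-24197`.
References: [folklore].
-/

set_option autoImplicit false

noncomputable section

open MeasureTheory Quaternion Set
open scoped Quaternion BigOperators ENNReal
open Literature.MathematicalPhysics.QuantumLattice
open Literature.MathematicalPhysics.QuantumFieldTheory hiding SU2

namespace Summit.QuantumFields.YangMills.Theorems.SwapVirialDeficit.SectorLaplace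

open Summit.QuantumFields.YangMills.Theorems.FemtoTransferGap
open Summit.QuantumFields.YangMills.Theorems.FemtoTransferGap.TT
open Summit.QuantumFields.YangMills.Theorems.SwapVirialDeficit.BlowUpRing
open Summit.QuantumFields.YangMills.Theorems.SwapVirialDeficit.Gnomonic (normSq3 normSq3_smul normSq3_nonneg gnomonicWeight)
open Summit.QuantumFields.YangMills.Theorems.SwapVirialDeficit.SigmaBall (lintegral_plane_pi_le)

/-! ## §1 Letters -/

/-- Lagrange: `|x×y|² = |x|²|y|² − (x·y)²`. [folklore] -/
theorem crossSq_eq_lagrange (x y : Fin 3 → ℝ) :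
    (x 1 * y 2 - x 2 * y 1) ^ 2 + (x 2 * y 0 - x 0 * y 2) ^ 2 + (x 0 * y 1 - x 1 * y 0) ^ 2 =
      normSq3 x * normSq3 y - (x 0 * y 0 + x 1 * y 1 + x 2 * y 2) ^ 2 := by
  rw [normSq3_eq_three', normSq3_eq_three']; ring

/-- `gnomonicWeight` is continuous. [folklore] -/
theorem continuous_normSq3 : Continuous (normSq3 : (Fin 3 → ℝ) → ℝ) := by
  unfold normSq3; fun_prop

/-- In the aligned frame (`rot3 u e₀ = x̂`): `x·(rot3 u Y) = √N·Y₀`, `|x × rot3 u Y|² = N·(Y₁²+Y₂²)`, `|rot3 u Y|² = |Y|²`. [folklore] -/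
theorem aligned_frame_letters {u : ℍ} (hu : ‖u‖ = 1) {x : Fin 3 → ℝ} (hx : 0 < normSq3 x)
    (hrot : rot3 u ![1, 0, 0] = (Real.sqrt (normSq3 x))⁻¹ • x) (Y : Fin 3 → ℝ) :
    x 0 * rot3 u Y 0 + x 1 * rot3 u Y 1 + x 2 * rot3 u Y 2 = Real.sqrt (normSq3 x) * Y 0 ∧
      (x 1 * rot3 u Y 2 - x 2 * rot3 u Y 1) ^ 2 + (x 2 * rot3 u Y 0 - x 0 * rot3 u Y 2) ^ 2 + (x 0 * rot3 u Y 1 - x 1 * rot3 u Y 0) ^ 2 =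
        normSq3 x * (Y 1 ^ 2 + Y 2 ^ 2) ∧
      normSq3 (rot3 u Y) = normSq3 Y := by
  obtain ⟨hdot, htr⟩ := rot3_frame_coords hu hrot Y
  have hr : 0 < Real.sqrt (normSq3 x) := Real.sqrt_pos.2 hx
  have hr2 : Real.sqrt (normSq3 x) ^ 2 = normSq3 x := Real.sq_sqrt hx.le
  have hsum : ∑ i, rot3 u Y i * ((Real.sqrt (normSq3 x))⁻¹ • x) i =
      (Real.sqrt (normSq3 x))⁻¹ * (x 0 * rot3 u Y 0 + x 1 * rot3 u Y 1 + x 2 * rot3 u Y 2) := by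
    rw [Fin.sum_univ_three]; simp only [Pi.smul_apply, smul_eq_mul]; ring
  rw [hsum] at hdot htr
  have h1 : x 0 * rot3 u Y 0 + x 1 * rot3 u Y 1 + x 2 * rot3 u Y 2 = Real.sqrt (normSq3 x) * Y 0 := by
    have := congrArg (fun t => Real.sqrt (normSq3 x) * t) hdot
    rw [← mul_assoc, mul_inv_cancel₀ hr.ne', one_mul] at this
    exact this
  have hN : normSq3 (rot3 u Y) = normSq3 Y := normSq3_rot3 hu Y
  refine ⟨h1, ?_, hN⟩
  rw [crossSq_eq_lagrange, hN, h1]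
  rw [h1, hN, ← mul_assoc, inv_mul_cancel₀ hr.ne', one_mul] at htr
  nlinarith [htr, hr2]

/-! ## §2 The transverse integral -/

set_option maxHeartbeats 1600000 in
/-- ★★ **THE TRANSVERSE INTEGRAL OF THE ALIGNED FRAME** (see the file header). [folklore] -/
theorem lintegral_transverse_le {x : Fin 3 → ℝ} (hx : 0 < normSq3 x) {β : ℝ} (hβ : 0 < β) {K : ℝ × ℝ → ℝ≥0∞} (hK : Measurable K) :
    ∫⁻ y : Fin 3 → ℝ, {y : Fin 3 → ℝ | normSq3 y ≤ normSq3 x}.indicator (fun y =>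
        ENNReal.ofReal (gnomonicWeight y * Real.exp (-(β * (4 * ((x 1 * y 2 - x 2 * y 1) ^ 2 + (x 2 * y 0 - x 0 * y 2) ^ 2 + (x 0 * y 1 - x 1 * y 0) ^ 2) /
          ((1 + normSq3 x) * (1 + normSq3 y)))))) *
        K (Real.sqrt (normSq3 x), (Real.sqrt (normSq3 x))⁻¹ * (x 0 * y 0 + x 1 * y 1 + x 2 * y 2))) y ≤
      ENNReal.ofReal (Real.pi ^ 2 * (1 + normSq3 x) / (4 * β * normSq3 x)) *
        ∫⁻ b : ℝ, {b : ℝ | b ^ 2 ≤ normSq3 x}.indicator (fun b => ENNReal.ofReal ((1 + b ^ 2)⁻¹) * K (Real.sqrt (normSq3 x), b)) b := by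
  set N : ℝ := normSq3 x with hNdef
  set r : ℝ := Real.sqrt N with hr
  have hr0 : 0 < r := Real.sqrt_pos.2 hx
  -- the aligned rotation
  have hunit : normSq3 (r⁻¹ • x) = 1 := by rw [normSq3_smul, inv_pow, hr, Real.sq_sqrt hx.le, ← hNdef, inv_mul_cancel₀ hx.ne']
  obtain ⟨u, hu, hrot⟩ := exists_rot3_e0_eq _ hunit
  -- the integrand and its rotated form
  set G : (Fin 3 → ℝ) → ℝ≥0∞ := fun y => {y : Fin 3 → ℝ | normSq3 y ≤ N}.indicator (fun y =>
        ENNReal.ofReal (gnomonicWeight y * Real.exp (-(β * (4 * ((x 1 * y 2 - x 2 * y 1) ^ 2 + (x 2 * y 0 - x 0 * y 2) ^ 2 + (x 0 * y 1 - x 1 * y 0) ^ 2) /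
          ((1 + N) * (1 + normSq3 y)))))) * K (r, r⁻¹ * (x 0 * y 0 + x 1 * y 1 + x 2 * y 2))) y with hG
  set G' : (Fin 3 → ℝ) → ℝ≥0∞ := fun Y => {Y : Fin 3 → ℝ | normSq3 Y ≤ N}.indicator (fun Y =>
        ENNReal.ofReal (gnomonicWeight Y * Real.exp (-(β * (4 * (N * (Y 1 ^ 2 + Y 2 ^ 2)) / ((1 + N) * (1 + normSq3 Y)))))) * K (r, Y 0)) Y with hG'
  have hmeasN : Measurable (normSq3 : (Fin 3 → ℝ) → ℝ) := continuous_normSq3.measurable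
  have hS : MeasurableSet {y : Fin 3 → ℝ | normSq3 y ≤ N} := measurableSet_le hmeasN measurable_const
  have hw : Measurable (gnomonicWeight : (Fin 3 → ℝ) → ℝ) := by
    unfold gnomonicWeight; exact ((measurable_const.add hmeasN).inv).pow_const 2
  have hcr : Measurable fun y : Fin 3 → ℝ => 4 * ((x 1 * y 2 - x 2 * y 1) ^ 2 + (x 2 * y 0 - x 0 * y 2) ^ 2 + (x 0 * y 1 - x 1 * y 0) ^ 2) /
      ((1 + N) * (1 + normSq3 y)) :=
    Measurable.div (by fun_prop) (measurable_const.mul (measurable_const.add hmeasN))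
  have hcr' : Measurable fun Y : Fin 3 → ℝ => 4 * (N * (Y 1 ^ 2 + Y 2 ^ 2)) / ((1 + N) * (1 + normSq3 Y)) :=
    Measurable.div (by fun_prop) (measurable_const.mul (measurable_const.add hmeasN))
  have hdotm : Measurable fun y : Fin 3 → ℝ => r⁻¹ * (x 0 * y 0 + x 1 * y 1 + x 2 * y 2) := by fun_prop
  have hGm : Measurable G := by
    rw [hG]
    refine Measurable.indicator (Measurable.mul (Measurable.ennreal_ofReal (hw.mul (Real.measurable_exp.comp (hcr.const_mul β).neg)))
      (hK.comp (measurable_const.prodMk hdotm))) hS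
  have hG'm : Measurable G' := by
    rw [hG']
    refine Measurable.indicator (Measurable.mul (Measurable.ennreal_ofReal (hw.mul (Real.measurable_exp.comp (hcr'.const_mul β).neg)))
      (hK.comp (measurable_const.prodMk (measurable_pi_apply 0)))) hS
  -- rotate
  have hrot_eq : ∀ Y, G (rot3 u Y) = G' Y := by
    intro Y
    obtain ⟨hdotY, hcrossY, hNY⟩ := aligned_frame_letters hu hx hrot Y
    rw [← hNdef] at hcrossY
    rw [← hNdef, ← hr] at hdotY
    rw [hG, hG']
    simp only
    by_cases hY : normSq3 Y ≤ N
    · have hY' : rot3 u Y ∈ {y : Fin 3 → ℝ | normSq3 y ≤ N} := by simpa [Set.mem_setOf_eq, hNY] using hY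
      rw [Set.indicator_of_mem hY', Set.indicator_of_mem (by exact hY)]
      have hw : gnomonicWeight (rot3 u Y) = gnomonicWeight Y := by unfold gnomonicWeight; rw [hNY]
      rw [hw, hNY, hcrossY, hdotY, show r⁻¹ * (r * Y 0) = Y 0 by rw [← mul_assoc, inv_mul_cancel₀ hr0.ne', one_mul]]
    · have hY' : rot3 u Y ∉ {y : Fin 3 → ℝ | normSq3 y ≤ N} := by simpa [Set.mem_setOf_eq, hNY] using hY
      rw [Set.indicator_of_notMem hY', Set.indicator_of_notMem (by exact hY)]
  have step1 : ∫⁻ y, G y = ∫⁻ Y, G' Y := by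
    rw [lintegral_rot3_comp hu hGm]; exact lintegral_congr hrot_eq
  -- split `Y = (b, w̃)`
  set e := MeasurableEquiv.piFinSuccAbove (fun _ : Fin 3 => ℝ) 0 with he
  have step2 : ∫⁻ Y, G' Y = ∫⁻ b : ℝ, ∫⁻ w : Fin 2 → ℝ, G' (e.symm (b, w)) := lintegral_fin3_eq_lintegral_prod hG'm
  -- pointwise bound of the split integrand by the compressed plane Gaussian
  have hpt : ∀ (b : ℝ) (w : Fin 2 → ℝ), G' (e.symm (b, w)) ≤
      {b : ℝ | b ^ 2 ≤ N}.indicator (fun b => K (r, b)) b *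
        ENNReal.ofReal ((((1 + b ^ 2) + (w 0 ^ 2 + w 1 ^ 2)) ^ 2)⁻¹ * Real.exp (-((4 * β * N / (1 + N)) * (w 0 ^ 2 + w 1 ^ 2) / ((1 + b ^ 2) + (w 0 ^ 2 + w 1 ^ 2))))) := by
    intro b w
    obtain ⟨c0, c1, c2⟩ := piFinSuccAbove_symm_coords b w
    have hNe : normSq3 (e.symm (b, w)) = b ^ 2 + (w 0 ^ 2 + w 1 ^ 2) := by rw [normSq3_eq_three', he, c0, c1, c2]; ring
    rw [hG']
    simp only
    by_cases hmem : normSq3 (e.symm (b, w)) ≤ N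
    · have hb : b ∈ {b : ℝ | b ^ 2 ≤ N} := by
        simp only [Set.mem_setOf_eq]; rw [hNe] at hmem; nlinarith [sq_nonneg (w 0), sq_nonneg (w 1)]
      rw [Set.indicator_of_mem (by exact hmem), Set.indicator_of_mem hb, he, c0, c1, c2, ← he, mul_comm]
      refine mul_le_mul' le_rfl (le_of_eq ?_)
      congr 1
      unfold gnomonicWeight
      rw [hNe, inv_pow]
      congr 2
      · ring
      · congr 1; field_simp; ring
    · rw [Set.indicator_of_notMem (by exact hmem)]; exact zero_le
  -- the plane Gaussian
  have hplane : ∀ b : ℝ, ∫⁻ w : Fin 2 → ℝ, ENNReal.ofReal ((((1 + b ^ 2) + (w 0 ^ 2 + w 1 ^ 2)) ^ 2)⁻¹ *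
      Real.exp (-((4 * β * N / (1 + N)) * (w 0 ^ 2 + w 1 ^ 2) / ((1 + b ^ 2) + (w 0 ^ 2 + w 1 ^ 2))))) ≤
      ENNReal.ofReal (Real.pi ^ 2 / ((1 + b ^ 2) * (4 * β * N / (1 + N)))) := fun b =>
    lintegral_plane_pi_le (by positivity) (by positivity)
  calc ∫⁻ y, G y = ∫⁻ b : ℝ, ∫⁻ w : Fin 2 → ℝ, G' (e.symm (b, w)) := by rw [step1, step2]
    _ ≤ ∫⁻ b : ℝ, ∫⁻ w : Fin 2 → ℝ, {b : ℝ | b ^ 2 ≤ N}.indicator (fun b => K (r, b)) b *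
        ENNReal.ofReal ((((1 + b ^ 2) + (w 0 ^ 2 + w 1 ^ 2)) ^ 2)⁻¹ * Real.exp (-((4 * β * N / (1 + N)) * (w 0 ^ 2 + w 1 ^ 2) / ((1 + b ^ 2) + (w 0 ^ 2 + w 1 ^ 2))))) :=
        lintegral_mono fun b => lintegral_mono fun w => hpt b w
    _ = ∫⁻ b : ℝ, {b : ℝ | b ^ 2 ≤ N}.indicator (fun b => K (r, b)) b *
        ∫⁻ w : Fin 2 → ℝ, ENNReal.ofReal ((((1 + b ^ 2) + (w 0 ^ 2 + w 1 ^ 2)) ^ 2)⁻¹ * Real.exp (-((4 * β * N / (1 + N)) * (w 0 ^ 2 + w 1 ^ 2) / ((1 + b ^ 2) + (w 0 ^ 2 + w 1 ^ 2))))) := by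
        refine lintegral_congr fun b => ?_
        rw [lintegral_const_mul]
        exact Measurable.ennreal_ofReal (by fun_prop)
    _ ≤ ∫⁻ b : ℝ, {b : ℝ | b ^ 2 ≤ N}.indicator (fun b => K (r, b)) b * ENNReal.ofReal (Real.pi ^ 2 / ((1 + b ^ 2) * (4 * β * N / (1 + N)))) :=
        lintegral_mono fun b => mul_le_mul' le_rfl (hplane b)
    _ = ∫⁻ b : ℝ, ENNReal.ofReal (Real.pi ^ 2 * (1 + N) / (4 * β * N)) * {b : ℝ | b ^ 2 ≤ N}.indicator (fun b => ENNReal.ofReal ((1 + b ^ 2)⁻¹) * K (r, b)) b := by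
        refine lintegral_congr fun b => ?_
        by_cases hb : b ∈ {b : ℝ | b ^ 2 ≤ N}
        · rw [Set.indicator_of_mem hb, Set.indicator_of_mem hb]
          have e1 : Real.pi ^ 2 / ((1 + b ^ 2) * (4 * β * N / (1 + N))) = Real.pi ^ 2 * (1 + N) / (4 * β * N) * (1 + b ^ 2)⁻¹ := by
            field_simp
          rw [e1, ENNReal.ofReal_mul (by positivity)]
          ring
        · rw [Set.indicator_of_notMem hb, Set.indicator_of_notMem hb]; simp
    _ = ENNReal.ofReal (Real.pi ^ 2 * (1 + N) / (4 * β * N)) *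
        ∫⁻ b : ℝ, {b : ℝ | b ^ 2 ≤ N}.indicator (fun b => ENNReal.ofReal ((1 + b ^ 2)⁻¹) * K (r, b)) b :=
        lintegral_const_mul' _ _ ENNReal.ofReal_ne_top

end Summit.QuantumFields.YangMills.Theorems.SwapVirialDeficit.SectorLaplace

end
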